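import Literature.AnabelianGeometry.AbsoluteAnabelian.ProfiniteSlimAscent
import HarnessLib

/-!
# The hypothesis «no nontrivial finite normal subgroup» in the slimness ascent is NECESSARY (schema remark)

Companion NEGATIVE note to `ProfiniteSlimAscent.lean` (abc-iut-w6-d071, p433420) for node AbsTopI:Prop2.3(i) of the
abc-iut cell (abc-iut-L4-lead RULING #7a «P23i-FN-ORIGIN», abstract branch).  S. Mochizuki, [AbsTopI] §0 p. 8 /
Def 1.1 (ii) p. 10 / Def 2.1 (i) p. 17 / Prop 2.3 (i) p. 19 (lit key `paper:url-11ac98ba15fc`).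

`isSlimGroup_of_isOpen_slim_of_forall_finite_normal_eq_bot` says: a compact group with an OPEN SLIM subgroup and NO
nontrivial finite normal subgroup — hypothesis (FN) — is slim.  Here, for EVERY topological group `P` and every
nontrivial finite discrete group `F`, the product `P × F`:
* has the open subgroup `P × 1`, which is slim as soon as `P` is (`isSlimGroup_prodTopBot`);
* has the nontrivial finite normal subgroup `1 × F` (`exists_finite_normal_ne_bot_prod`), so (FN) FAILS;
* is NOT slim (`not_isSlimGroup_prod`: `(1, f)` centralises the open subgroup `P × 1`).
Hence (FN) cannot be dropped from the ascent theorem, and «`Δ` has an open slim (∧ elastic) pro-`Σ` surface-group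
subgroup» does NOT by itself give «`Δ` slim» — for print's almost pro-`Σ` `Δ_X` of GFG-type the missing input is the
GEOMETRIC origin (Def 2.1 (i)), which the tree types only abstractly (`FundamentalExtension`,
`AbsTopI.ConstructionDataClass`).  PROOF-ONLY schema remark over arbitrary `P`, `F` (instantiate `P` := any slim
profinite group of the tree, `F := ℤ/2`); it refutes nothing in print.  Classical; nothing here bears on [IUTchIII]
Cor. 3.12.
-/

noncomputable section

open Topology

universe u v

namespace Literature.AnabelianGeometry.AbsoluteAnabelian

open Literature.AlgebraicGeometry.Frobenioids (IsSlimGroup)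

variable {P : Type u} [Group P] [TopologicalSpace P]
variable {F : Type v} [Group F] [TopologicalSpace F]

/-- Slimness is invariant under isomorphisms of topological groups (transport of the centraliser condition).
[cite: MochizukiAbsTopI2012, §0 p.8] -/
theorem IsSlimGroup.of_continuousMulEquiv_left {Q : Type v} [Group Q] [TopologicalSpace Q]
    (e : P ≃ₜ* Q) (hP : IsSlimGroup P) : IsSlimGroup Q := by
  refine ⟨fun V hV => ?_⟩
  have hVo : IsOpen ((V.comap e.toMulEquiv.toMonoidHom : Subgroup P) : Set P) := hV.preimage e.continuous
  have hc := hP.centralizer_eq_bot _ hVo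
  rw [eq_bot_iff]
  intro q hq
  rw [Subgroup.mem_centralizer_iff] at hq
  have hmem : e.symm q ∈ Subgroup.centralizer ((V.comap e.toMulEquiv.toMonoidHom : Subgroup P) : Set P) := by
    rw [Subgroup.mem_centralizer_iff]
    intro p hp
    have hp' : e p ∈ V := hp
    apply e.injective
    simp only [map_mul, ContinuousMulEquiv.apply_symm_apply]
    exact hq _ hp'
  rw [hc, Subgroup.mem_bot] at hmem
  rw [Subgroup.mem_bot, ← e.apply_symm_apply q, hmem, map_one]

variable (P F)

/-- `P × 1` is OPEN in `P × F` when `F` is discrete (it is the fibre of the second projection over `1`).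
[cite: MochizukiAbsTopI2012, §0 p.8] -/
theorem isOpen_prodTopBot [DiscreteTopology F] : IsOpen ((Subgroup.prod ⊤ ⊥ : Subgroup (P × F)) : Set (P × F)) := by
  have h : ((Subgroup.prod ⊤ ⊥ : Subgroup (P × F)) : Set (P × F)) = Prod.snd ⁻¹' {1} := by
    ext x
    simp [Subgroup.mem_prod]
  rw [h]
  exact (isOpen_discrete _).preimage continuous_snd

omit [TopologicalSpace P] [TopologicalSpace F] in
/-- `(x, 1) ∈ P × 1`. [cite: MochizukiAbsTopI2012, §0 p.8] -/
theorem mk_one_mem_prodTopBot (x : P) : (x, (1 : F)) ∈ (Subgroup.prod ⊤ ⊥ : Subgroup (P × F)) := by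
  simp [Subgroup.mem_prod]

omit [TopologicalSpace P] [TopologicalSpace F] in
/-- The second coordinate of an element of `P × 1` is `1`. [cite: MochizukiAbsTopI2012, §0 p.8] -/
theorem snd_eq_one_of_mem_prodTopBot {y : P × F} (hy : y ∈ (Subgroup.prod ⊤ ⊥ : Subgroup (P × F))) : y.2 = 1 := by
  simpa [Subgroup.mem_prod] using hy

/-- `P × 1` is slim whenever `P` is (transport along the topological-group isomorphism `P ≅ P × 1`,
`x ↦ (x, 1)`). [cite: MochizukiAbsTopI2012, §0 p.8] -/
theorem isSlimGroup_prodTopBot (hP : IsSlimGroup P) :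
    IsSlimGroup (Subgroup.prod ⊤ ⊥ : Subgroup (P × F)) := by
  let e : P ≃ₜ* (Subgroup.prod ⊤ ⊥ : Subgroup (P × F)) :=
    { toFun := fun x => ⟨(x, 1), mk_one_mem_prodTopBot P F x⟩
      invFun := fun y => (y : P × F).1
      left_inv := fun _ => rfl
      right_inv := fun y => Subtype.ext (Prod.ext rfl (snd_eq_one_of_mem_prodTopBot P F y.2).symm)
      map_mul' := fun _ _ => Subtype.ext (Prod.ext rfl (one_mul (1 : F)).symm)
      continuous_toFun := (continuous_id.prodMk continuous_const).subtype_mk _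
      continuous_invFun := continuous_fst.comp continuous_subtype_val }
  exact IsSlimGroup.of_continuousMulEquiv_left e hP

omit [TopologicalSpace P] [TopologicalSpace F] in
/-- `1 × F` is a nontrivial finite normal subgroup of `P × F` (for `F` finite and nontrivial): (FN) FAILS for
`P × F`. [cite: MochizukiAbsTopI2012, §0 p.8] -/
theorem exists_finite_normal_ne_bot_prod [Finite F] [Nontrivial F] :
    ∃ N : Subgroup (P × F), N.Normal ∧ (N : Set (P × F)).Finite ∧ N ≠ ⊥ := by
  refine ⟨Subgroup.prod ⊥ ⊤, inferInstance, ?_, ?_⟩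
  · have h : ((Subgroup.prod ⊥ ⊤ : Subgroup (P × F)) : Set (P × F)) = Prod.fst ⁻¹' {1} := by
      ext x
      simp [Subgroup.mem_prod]
    rw [h]
    have h2 : (Prod.fst ⁻¹' {1} : Set (P × F)) = Set.range fun f : F => ((1 : P), f) := by
      ext ⟨a, b⟩
      simp [eq_comm]
    rw [h2]
    exact Set.finite_range _
  · obtain ⟨f, hf⟩ := exists_ne (1 : F)
    intro h
    have hmem : ((1 : P), f) ∈ (Subgroup.prod ⊥ ⊤ : Subgroup (P × F)) := by simp [Subgroup.mem_prod]
    rw [h, Subgroup.mem_bot, Prod.mk_eq_one] at hmem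
    exact hf hmem.2

/-- `P × F` is NOT slim for `F` nontrivial: every `(1, f)` centralises the open subgroup `P × 1`.
[cite: MochizukiAbsTopI2012, §0 p.8] -/
theorem not_isSlimGroup_prod [DiscreteTopology F] [Nontrivial F] : ¬ IsSlimGroup (P × F) := by
  intro h
  obtain ⟨f, hf⟩ := exists_ne (1 : F)
  have hc := h.centralizer_eq_bot _ (isOpen_prodTopBot P F)
  have hmem : ((1 : P), f) ∈ Subgroup.centralizer ((Subgroup.prod ⊤ ⊥ : Subgroup (P × F)) : Set (P × F)) := by
    rw [Subgroup.mem_centralizer_iff]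
    rintro ⟨a, b⟩ hab
    have hb : b = 1 := by simpa [Subgroup.mem_prod] using hab
    subst hb
    simp
  rw [hc, Subgroup.mem_bot, Prod.mk_eq_one] at hmem
  exact hf hmem.2

/-- **Sharpness of the slimness ascent**: for every slim `P` and every nontrivial finite discrete `F`, the group
`P × F` has an OPEN SLIM subgroup and yet is NOT slim and violates (FN) — so (FN) is a necessary hypothesis of
`isSlimGroup_of_isOpen_slim_of_forall_finite_normal_eq_bot`, and an open slim (pro-`Σ` surface) subgroup alone
does not make an almost pro-`Σ` group slim. [cite: MochizukiAbsTopI2012, Prop 2.3 (i) p.19] -/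
theorem slimAscent_hypothesis_necessary [DiscreteTopology F] [Finite F] [Nontrivial F] (hP : IsSlimGroup P) :
    (∃ U : Subgroup (P × F), IsOpen (U : Set (P × F)) ∧ IsSlimGroup U) ∧
      (∃ N : Subgroup (P × F), N.Normal ∧ (N : Set (P × F)).Finite ∧ N ≠ ⊥) ∧ ¬ IsSlimGroup (P × F) :=
  ⟨⟨Subgroup.prod ⊤ ⊥, isOpen_prodTopBot P F, isSlimGroup_prodTopBot P F hP⟩,
    exists_finite_normal_ne_bot_prod P F, not_isSlimGroup_prod P F⟩

end Literature.AnabelianGeometry.AbsoluteAnabelian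

end
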